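import Literature.MathematicalPhysics.QuantumLattice.FreeFermiGasNoPairFieldLRO
import Literature.MathematicalPhysics.QuantumLattice.HubbardRingPerronFrobeniusProofs
import Literature.MathematicalPhysics.QuantumLattice.FermionOperatorsSpinHermitianProofs
import HarnessLib

/-!
# Kinetic energy above the free sector ground energy controls the occupation deviations

Family `hubbard` / trunk T-QLATTICE. For the FREE (`U = 0`, `t = 1`) Hubbard Hamiltonian
`H₀ = hubbardTorus 2 L 1 0 = Σ_{kσ} ε_L(k) n_{kσ}` on the fermionic torus `(ℤ/Lℤ)²` (`L ≥ 3`) and a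
unit vector `ψ` of the joint sector `szSector (2n) 0` (`n` up and `n` down electrons), with Bloch
occupations `x_k = Re ⟨ψ, n_{k↑} ψ⟩ ∈ [0,1]`:

  `Σ_k |ε_L(k) - ε_F| · x_k (1 - x_k) ≤ Re ⟨ψ, H₀ ψ⟩ - minEnergyOn H₀ (szSector (2n) 0)`

(`sum_abs_sub_fermiLevel_mul_le_energy_excess`) for a Fermi level `ε_F` of the `n` lowest band
energies: a state whose kinetic energy exceeds the free sector ground energy by `X` has its
momentum distribution pinned to a Fermi sea except for a layer of energy-weighted width `X`.
Ingredients, all elementary and proved here: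

* the **bathtub bound with deviations** (`sum_fermiSet_add_deviation_le`, real variables): for
  `0 ≤ x_k ≤ 1` with `Σ_k x_k = |F|` and `F` a set of `|F|` lowest levels with Fermi level `ε_F`
  (`exists_fermiSet`: a sum-minimising `|F|`-subset, exchange argument),
  `Σ_{k∈F} ε_k + Σ_k |ε_k - ε_F| x_k(1 - x_k) ≤ Σ_k ε_k x_k`;
* **Parseval per spin** (`sum_momentumNumber_eq_sum_numberOp`: `Σ_k n_{kσ} = Σ_x n_{xσ}`), whence on
  Lieb's sector `(a, b)` the Bloch occupations sum to `a` resp. `b`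
  (`sum_re_expect_momentumNumber_up/down`);
* the **paired trial state** `Φ_F = Π_{k∈F} b_k† |0⟩` (`PairedProductStates.lean`) lies in
  `szSector (2|F|) 0` and has `⟨Φ_F, H₀ Φ_F⟩ = 2 Σ_{k∈F} ε_L(k)`, so
  `minEnergyOn H₀ (szSector (2|F|) 0) ≤ 2 Σ_{k∈F} ε_L(k)` (`minEnergyOn_szSector_hubbardTorus_zero_le`).

Consumer: `FreeFermiGasPairingCost.lean` (`d`-wave pair LRO of the free Fermi sea costs kinetic
energy at a volume rate — the hypothesis `FreeDWavePairingCostsEnergy` of the disprover of crux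
`BirGroundStateAverageLRO`, route `HubbardSuperconductivity/BalabanIR`, made a theorem).

Sources: E. H. Lieb, M. Loss, *Analysis* (2001), Thm 1.14 (bathtub principle); J. Bardeen,
L. N. Cooper, J. R. Schrieffer, Phys. Rev. 108 (1957) 1175, §II (kinetic energy of a smeared Fermi
surface, `2 Σ_k |ε_k| h_k` bookkeeping); E. H. Lieb, PRL 62 (1989) 1201 (the `(n,n)` sector).
Folklore finite-dimensional statements; no named facts, no definitions.

## Mathlib / tree search

Tree: `momentumNumber`, `momentumCreation_eq_sum`, `sum_torusFourierWeight_mul_torusChar_mul_conj`,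
`hubbardTorusWith_zero_eq_sum_pairBlock_kinetic`, `star_pairedState_dotProduct_pairNumber_mulVec`,
`star_pairedState_dotProduct_self`, `pairMode_conjTranspose`, `spinZ_commute_pairMode`,
`IsNParticle.creation_mulVec_holds`, `LiebThm1.numberOp_eq_diagonal`, `LiebThm1.spinZ_mulVec_apply`,
`card_eq_upPart_add_downPart`, `IsInSector`, `mem_szSector_two_mul_zero_iff`,
`minEnergyOn_le_rayleigh_of_mem`, `momentumNumber_mul_self`, `momentumNumber_conjTranspose`,
`Literature.Computability.AlgebraicComplexity.re_dotProduct_mulVec_nonneg/le`, `torusBand_neg`.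
Mathlib: `Finset.exists_min_image`, `Finset.powersetCard_nonempty`, `Finset.sum_erase_eq_sub`.
-/

noncomputable section

namespace Literature.MathematicalPhysics.QuantumLattice

open Matrix Finset Literature.Probability.LatticeModels
open scoped ComplexOrder ComplexConjugate

/-! ### The bathtub bound with deviations -/

section Bathtub

variable {ι : Type*} [Fintype ι] [DecidableEq ι]

/-- **A set of `n` lowest levels and its Fermi level.** For `ε : ι → ℝ` on a finite type and
`n ≤ |ι|` there are `F` with `|F| = n` and `ε_F` with `ε ≤ ε_F` on `F` and `ε_F ≤ ε` off `F` (a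
`Σ_F ε`-minimising `n`-subset; exchange argument). Lieb–Loss (2001) Thm 1.14. [folklore] -/
theorem exists_fermiSet (ε : ι → ℝ) {n : ℕ} (hn : n ≤ Fintype.card ι) :
    ∃ (F : Finset ι) (eF : ℝ), F.card = n ∧ (∀ k ∈ F, ε k ≤ eF) ∧ (∀ k ∉ F, eF ≤ ε k) := by
  have hne : (Finset.powersetCard n (Finset.univ : Finset ι)).Nonempty :=
    Finset.powersetCard_nonempty.2 (by rwa [Finset.card_univ])
  obtain ⟨F, hF, hmin⟩ := Finset.exists_min_image _ (fun G : Finset ι => ∑ k ∈ G, ε k) hne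
  rw [Finset.mem_powersetCard] at hF
  have hcard : F.card = n := hF.2
  -- exchange property of a minimiser
  have hex : ∀ k ∈ F, ∀ k' ∉ F, ε k ≤ ε k' := by
    intro k hk k' hk'
    by_contra hlt
    push Not at hlt
    have hk'e : k' ∉ F.erase k := fun h => hk' (Finset.mem_of_mem_erase h)
    have hG : insert k' (F.erase k) ∈ Finset.powersetCard n (Finset.univ : Finset ι) := by
      rw [Finset.mem_powersetCard]
      refine ⟨Finset.subset_univ _, ?_⟩
      rw [Finset.card_insert_of_notMem hk'e, Finset.card_erase_of_mem hk, hcard]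
      have : 0 < n := by rw [← hcard]; exact Finset.card_pos.2 ⟨k, hk⟩
      omega
    have h1 := hmin _ hG
    rw [Finset.sum_insert hk'e, Finset.sum_erase_eq_sub hk] at h1
    linarith
  by_cases hFne : F.Nonempty
  · refine ⟨F, F.sup' hFne ε, hcard, fun k hk => Finset.le_sup' ε hk, fun k' hk' => ?_⟩
    obtain ⟨k₀, hk₀, hk₀eq⟩ := Finset.exists_mem_eq_sup' hFne ε
    rw [hk₀eq]
    exact hex k₀ hk₀ k' hk'
  · rw [Finset.not_nonempty_iff_eq_empty] at hFne
    by_cases hι : (Finset.univ : Finset ι).Nonempty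
    · refine ⟨F, Finset.univ.inf' hι ε, hcard, ?_, fun k' _ => Finset.inf'_le ε (Finset.mem_univ k')⟩
      rw [hFne]; simp
    · refine ⟨F, 0, hcard, ?_, fun k' _ => absurd ⟨k', Finset.mem_univ k'⟩ hι⟩
      rw [hFne]; simp

omit [DecidableEq ι] in
/-- **Bathtub bound with deviations.** If `0 ≤ x_k ≤ 1`, `Σ_k x_k = |F|`, and `ε_F` separates the
levels of `F` (below) from the others (above), then
`Σ_{k∈F} ε_k + Σ_k |ε_k - ε_F| · x_k (1 - x_k) ≤ Σ_k ε_k x_k`: filling `F` is optimal, and every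
unit of "smearing" `x_k(1-x_k)` costs its distance to the Fermi level. Lieb–Loss (2001) Thm 1.14;
Bardeen–Cooper–Schrieffer (1957) §II. [folklore] -/
theorem sum_fermiSet_add_deviation_le (ε x : ι → ℝ) (F : Finset ι) (eF : ℝ)
    (hF : ∀ k ∈ F, ε k ≤ eF) (hF' : ∀ k ∉ F, eF ≤ ε k)
    (hx0 : ∀ k, 0 ≤ x k) (hx1 : ∀ k, x k ≤ 1) (hsum : ∑ k, x k = F.card) :
    ∑ k ∈ F, ε k + ∑ k, |ε k - eF| * (x k * (1 - x k)) ≤ ∑ k, ε k * x k := by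
  classical
  have key : ∀ k, |ε k - eF| * (x k * (1 - x k)) ≤
      (ε k - eF) * x k - (if k ∈ F then ε k - eF else 0) := by
    intro k
    have h0 := hx0 k
    have h1 := hx1 k
    by_cases hk : k ∈ F
    · rw [if_pos hk, abs_of_nonpos (by linarith [hF k hk])]
      nlinarith [mul_nonneg (sub_nonneg.2 (hF k hk)) (sq_nonneg (1 - x k))]
    · rw [if_neg hk, abs_of_nonneg (by linarith [hF' k hk]), sub_zero]
      nlinarith [mul_nonneg (sub_nonneg.2 (hF' k hk)) (sq_nonneg (x k))]
  have hs := Finset.sum_le_sum fun k (_ : k ∈ Finset.univ) => key k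
  rw [Finset.sum_sub_distrib, Finset.sum_ite_mem, Finset.univ_inter] at hs
  have e1 : ∑ k, (ε k - eF) * x k = ∑ k, ε k * x k - eF * F.card := by
    rw [← hsum, Finset.mul_sum, ← Finset.sum_sub_distrib]
    refine Finset.sum_congr rfl fun k _ => by ring
  have e2 : ∑ k ∈ F, (ε k - eF) = ∑ k ∈ F, ε k - eF * F.card := by
    rw [Finset.sum_sub_distrib, Finset.sum_const, nsmul_eq_mul, mul_comm]
  rw [e1, e2] at hs
  linarith

omit [DecidableEq ι] in
/-- The bathtub bound without the deviation term: `Σ_{k∈F} ε_k ≤ Σ_k ε_k x_k`. [folklore] -/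
theorem sum_fermiSet_le (ε x : ι → ℝ) (F : Finset ι) (eF : ℝ)
    (hF : ∀ k ∈ F, ε k ≤ eF) (hF' : ∀ k ∉ F, eF ≤ ε k)
    (hx0 : ∀ k, 0 ≤ x k) (hx1 : ∀ k, x k ≤ 1) (hsum : ∑ k, x k = F.card) :
    ∑ k ∈ F, ε k ≤ ∑ k, ε k * x k := by
  have h := sum_fermiSet_add_deviation_le ε x F eF hF hF' hx0 hx1 hsum
  have h0 : 0 ≤ ∑ k, |ε k - eF| * (x k * (1 - x k)) :=
    Finset.sum_nonneg fun k _ => mul_nonneg (abs_nonneg _)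
      (mul_nonneg (hx0 k) (by linarith [hx1 k]))
  linarith

end Bathtub

/-! ### Parseval per spin; Bloch occupations on Lieb's sectors -/

section Parseval

variable {L : ℕ} [NeZero L]

/-- **Parseval per spin** (any dimension `d`): `Σ_k n_{kσ} = Σ_x n_{xσ}` (completeness of the
normalised characters). von Delft–Ralph (2001) §4.2.3. [folklore] -/
theorem sum_momentumNumber_eq_sum_numberOp {d : ℕ} (σ : Fin 2) :
    ∑ k : TorusSite d L, momentumNumber k σ = ∑ x : FermionTorus d L, numberOp x σ := by
  have hk : ∀ k : TorusSite d L, momentumNumber k σ =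
      ∑ x : FermionTorus d L, ∑ y : FermionTorus d L,
        (torusFourierWeight d L * torusChar k x.toTorusSite *
          (torusFourierWeight d L * conj (torusChar k y.toTorusSite))) •
          (creation (orb x σ) * annihilation (orb y σ)) := by
    intro k
    rw [momentumNumber, momentumCreation_eq_sum]
    unfold momentumAnnihilation
    rw [Finset.sum_mul_sum]
    refine Finset.sum_congr rfl fun x _ => Finset.sum_congr rfl fun y _ => ?_
    rw [smul_mul_smul_comm]
  simp_rw [hk]
  rw [Finset.sum_comm]
  refine Finset.sum_congr rfl fun x _ => ?_
  rw [Finset.sum_comm]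
  simp_rw [← Finset.sum_smul, sum_torusFourierWeight_mul_torusChar_mul_conj, ite_smul, one_smul,
    zero_smul, Finset.sum_ite_eq, Finset.mem_univ, if_true, numberOp]

/-- `(Σ_x n_{x↑}) |s⟩ = N↑(s) |s⟩`, `(Σ_x n_{x↓}) |s⟩ = N↓(s) |s⟩`. Lieb (1989) eq. (2). [folklore] -/
theorem sum_numberOp_mulVec_apply {Λ : Type*} [LinearOrder Λ] [Fintype Λ] (σ : Fin 2)
    (ψ : Fock (Orb Λ)) (s : Finset (Orb Λ)) :
    ((∑ x : Λ, numberOp x σ) *ᵥ ψ) s =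
      ((Finset.univ.filter fun x : Λ => orb x σ ∈ s).card : ℂ) * ψ s := by
  rw [Matrix.sum_mulVec, Finset.sum_apply]
  simp only [LiebThm1.numberOp_eq_diagonal, mulVec_diagonal]
  rw [← Finset.sum_mul, Finset.sum_boole]

/-- **On Lieb's sector `(a, b)` the Bloch `↑`-occupations sum to `a`**:
`Σ_k Re ⟨ψ, n_{k↑} ψ⟩ = a · Re ⟨ψ, ψ⟩`. [folklore] -/
theorem sum_re_expect_momentumNumber_up {a b : ℕ} {ψ : Fock (Orb (FermionTorus 2 L))}
    (hψ : IsInSector a b ψ) :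
    ∑ k : TorusSite 2 L, (star ψ ⬝ᵥ (momentumNumber k 0 *ᵥ ψ)).re = a * (star ψ ⬝ᵥ ψ).re := by
  rw [← Complex.re_sum, ← dotProduct_sum, ← Matrix.sum_mulVec, sum_momentumNumber_eq_sum_numberOp,
    ← Complex.re_ofReal_mul, Complex.ofReal_natCast]
  congr 1
  simp only [dotProduct, Pi.star_apply, sum_numberOp_mulVec_apply, Finset.mul_sum]
  refine Finset.sum_congr rfl fun s _ => ?_
  by_cases hs : ψ s = 0
  · simp [hs]
  · have h := not_imp_comm.1 (hψ s) hs
    have hup : ∀ inst : DecidablePred fun x : FermionTorus 2 L => orb x 0 ∈ s,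
        (@Finset.filter _ (fun x => orb x 0 ∈ s) inst Finset.univ).card = a := by
      intro inst; rw [← h.1]; congr 1; ext x; simp
    rw [hup]
    ring

/-- **On Lieb's sector `(a, b)` the Bloch `↓`-occupations sum to `b`**:
`Σ_k Re ⟨ψ, n_{k↓} ψ⟩ = b · Re ⟨ψ, ψ⟩`. [folklore] -/
theorem sum_re_expect_momentumNumber_down {a b : ℕ} {ψ : Fock (Orb (FermionTorus 2 L))}
    (hψ : IsInSector a b ψ) :
    ∑ k : TorusSite 2 L, (star ψ ⬝ᵥ (momentumNumber k 1 *ᵥ ψ)).re = b * (star ψ ⬝ᵥ ψ).re := by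
  rw [← Complex.re_sum, ← dotProduct_sum, ← Matrix.sum_mulVec, sum_momentumNumber_eq_sum_numberOp,
    ← Complex.re_ofReal_mul, Complex.ofReal_natCast]
  congr 1
  simp only [dotProduct, Pi.star_apply, sum_numberOp_mulVec_apply, Finset.mul_sum]
  refine Finset.sum_congr rfl fun s _ => ?_
  by_cases hs : ψ s = 0
  · simp [hs]
  · have h := not_imp_comm.1 (hψ s) hs
    have hdown : ∀ inst : DecidablePred fun x : FermionTorus 2 L => orb x 1 ∈ s,
        (@Finset.filter _ (fun x => orb x 1 ∈ s) inst Finset.univ).card = b := by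
      intro inst; rw [← h.2]; congr 1; ext x; simp [downPart]
    rw [hdown]
    ring

/-- The Bloch occupation `Re ⟨ψ, n_{kσ} ψ⟩` lies in `[0, Re ⟨ψ, ψ⟩]` (`n_{kσ}` is an orthogonal
projection). [folklore] -/
theorem re_expect_momentumNumber_mem_Icc (k : TorusSite 2 L) (σ : Fin 2)
    (ψ : Fock (Orb (FermionTorus 2 L))) :
    (star ψ ⬝ᵥ (momentumNumber k σ *ᵥ ψ)).re ∈ Set.Icc 0 (star ψ ⬝ᵥ ψ).re :=
  ⟨Literature.Computability.AlgebraicComplexity.re_dotProduct_mulVec_nonneg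
      (momentumNumber_conjTranspose k σ) (momentumNumber_mul_self k σ) ψ,
    Literature.Computability.AlgebraicComplexity.re_dotProduct_mulVec_le
      (momentumNumber_conjTranspose k σ) (momentumNumber_mul_self k σ) ψ⟩

/-- A nonzero vector of `szSector N 0` has `N` even (`N = N↑ + N↓`, `N↑ = N↓` on its support).
[folklore] -/
theorem exists_eq_two_mul_of_mem_szSector_zero {Λ : Type*} [LinearOrder Λ] [Fintype Λ] {N : ℕ}
    {ψ : Fock (Orb Λ)} (hψ : ψ ∈ szSector N 0) (h0 : ψ ≠ 0) : ∃ n : ℕ, N = 2 * n := by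
  obtain ⟨s, hs⟩ := Function.ne_iff.1 h0
  rw [mem_szSector_iff] at hψ
  obtain ⟨hN, hZ⟩ := hψ
  have hcard : s.card = N := by
    by_contra h
    exact hs (hN s h)
  have h := congrFun hZ s
  rw [LiebThm1.spinZ_mulVec_apply, Pi.smul_apply, smul_eq_mul, Complex.ofReal_zero, zero_mul,
    mul_eq_zero] at h
  rcases h with h1 | h1
  · rcases mul_eq_zero.1 h1 with h2 | h2
    · norm_num at h2
    · have h3 : ((upPart s).card : ℂ) = (downPart s).card := sub_eq_zero.1 h2
      have h4 : (upPart s).card = (downPart s).card := by exact_mod_cast h3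
      refine ⟨(upPart s).card, ?_⟩
      rw [← hcard, card_eq_upPart_add_downPart, ← h4, two_mul]
  · exact absurd h1 hs

end Parseval

/-! ### The paired trial state: sector membership and kinetic energy -/

section Trial

variable {L : ℕ} [NeZero L]

/-- The vacuum is a `0`-particle vector. [folklore] -/
theorem isNParticle_zero_vacuum {ι : Type*} [LinearOrder ι] : IsNParticle 0 (vacuum : Fock ι) := by
  intro s hs
  rw [vacuum, Pi.single_apply, if_neg]
  intro h
  exact hs (by rw [h, Finset.card_empty])

/-- `c†_{kσ}` raises the particle number by one. Bratteli–Robinson II §5.2.2. [folklore] -/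
theorem IsNParticle.momentumCreation_mulVec {N : ℕ} {ψ : Fock (Orb (FermionTorus 2 L))}
    (hψ : IsNParticle N ψ) (k : TorusSite 2 L) (σ : Fin 2) :
    IsNParticle (N + 1) (momentumCreation k σ *ᵥ ψ) := by
  rw [momentumCreation_eq_sum, Matrix.sum_mulVec]
  refine Submodule.sum_mem (nParticleSubmodule (N + 1)) fun x _ => ?_
  rw [Matrix.smul_mulVec]
  exact (nParticleSubmodule (N + 1)).smul_mem _ (IsNParticle.creation_mulVec_holds hψ _)

/-- `b†_k = c†_{k↑} c†_{-k↓}` raises the particle number by two. von Delft–Ralph (2001) §4.2.3.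
[folklore] -/
theorem IsNParticle.pairMode_conjTranspose_mulVec {N : ℕ} {ψ : Fock (Orb (FermionTorus 2 L))}
    (hψ : IsNParticle N ψ) (k : TorusSite 2 L) : IsNParticle (N + 2) ((pairMode k)ᴴ *ᵥ ψ) := by
  rw [pairMode_conjTranspose, ← mulVec_mulVec]
  exact (hψ.momentumCreation_mulVec _ _).momentumCreation_mulVec _ _

/-- `Φ_l` is a `2|l|`-particle vector. [folklore] -/
theorem isNParticle_pairedState (l : List (TorusSite 2 L)) : IsNParticle (2 * l.length) ((List.prod (List.map (fun k : TorusSite 2 L => (pairMode k)ᴴ) l)) *ᵥ (vacuum : Fock (Orb (FermionTorus 2 L)))) := by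
  induction l with
  | nil => rw [pairedState_nil]; exact isNParticle_zero_vacuum
  | cons k l ih =>
    rw [pairedState_cons, List.length_cons, show 2 * (l.length + 1) = 2 * l.length + 2 by ring]
    exact ih.pairMode_conjTranspose_mulVec k

/-- `S^z |0⟩ = 0`. [folklore] -/
theorem spinZ_mulVec_vacuum {Λ : Type*} [LinearOrder Λ] [Fintype Λ] :
    HubbardWave0.spinZ *ᵥ (vacuum : Fock (Orb Λ)) = 0 := by
  funext s
  rw [LiebThm1.spinZ_mulVec_apply, Pi.zero_apply]
  by_cases h : s = ∅
  · subst h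
    have hu : upPart (∅ : Finset (Orb Λ)) = ∅ := by ext x; simp
    have hd : downPart (∅ : Finset (Orb Λ)) = ∅ := by ext x; simp [downPart]
    rw [hu, hd]
    simp
  · have h0 : (vacuum : Fock (Orb Λ)) s = 0 := by rw [vacuum, Pi.single_apply, if_neg h]
    rw [h0, mul_zero]

/-- `S^z` commutes with `b†_k` (singlet pairs carry no spin). [folklore] -/
theorem spinZ_commute_pairMode_conjTranspose (k : TorusSite 2 L) :
    Commute HubbardWave0.spinZ (pairMode k)ᴴ := by
  have h2 := congrArg conjTranspose (spinZ_commute_pairMode k).eq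
  rw [conjTranspose_mul, conjTranspose_mul, HubbardWave0.spinZ_isHermitian.eq] at h2
  exact h2.symm

/-- `S^z Φ_l = 0`. [folklore] -/
theorem spinZ_mulVec_pairedState (l : List (TorusSite 2 L)) : HubbardWave0.spinZ *ᵥ ((List.prod (List.map (fun k : TorusSite 2 L => (pairMode k)ᴴ) l)) *ᵥ (vacuum : Fock (Orb (FermionTorus 2 L)))) = 0 := by
  induction l with
  | nil => rw [pairedState_nil]; exact spinZ_mulVec_vacuum
  | cons k l ih =>
    rw [pairedState_cons, mulVec_mulVec, (spinZ_commute_pairMode_conjTranspose k).eq, ← mulVec_mulVec,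
      ih, mulVec_zero]

/-- **`Φ_l` lies in the joint sector `(2|l|, S^z = 0)`.** [folklore] -/
theorem pairedState_mem_szSector (l : List (TorusSite 2 L)) :
    ((List.prod (List.map (fun k : TorusSite 2 L => (pairMode k)ᴴ) l)) *ᵥ (vacuum : Fock (Orb (FermionTorus 2 L)))) ∈ szSector (Λ := FermionTorus 2 L) (2 * l.length) 0 := by
  rw [mem_szSector_iff]
  refine ⟨isNParticle_pairedState l, ?_⟩
  rw [spinZ_mulVec_pairedState, Complex.ofReal_zero, zero_smul]

/-- **Kinetic energy of the paired trial state**: `⟨Φ_l, H₀ Φ_l⟩ = 2 Σ_{k ∈ l} ε_L(k)` for a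
duplicate-free `l` and `L ≥ 3` (`H₀ = hubbardTorus 2 L 1 0`). Bardeen–Cooper–Schrieffer (1957)
§II. [folklore] -/
theorem re_expect_hubbardTorus_zero_pairedState (hL : 3 ≤ L) {l : List (TorusSite 2 L)}
    (hl : l.Nodup) :
    (star ((List.prod (List.map (fun k : TorusSite 2 L => (pairMode k)ᴴ) l)) *ᵥ (vacuum : Fock (Orb (FermionTorus 2 L)))) ⬝ᵥ (hubbardTorus 2 L 1 0 *ᵥ ((List.prod (List.map (fun k : TorusSite 2 L => (pairMode k)ᴴ) l)) *ᵥ (vacuum : Fock (Orb (FermionTorus 2 L)))))).re = 2 * ∑ k ∈ l.toFinset, torusBand L k := by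
  rw [← hubbardTorusWith_zero, hubbardTorusWith_zero_eq_sum_pairBlock_kinetic hL 0, Matrix.sum_mulVec,
    dotProduct_sum]
  simp only [Matrix.smul_mulVec, dotProduct_smul, star_pairedState_dotProduct_pairNumber_mulVec hl,
    smul_eq_mul, mul_ite, mul_zero, sub_zero]
  rw [Complex.re_sum]
  simp only [apply_ite Complex.re, Complex.zero_re]
  rw [← Finset.sum_filter]
  have hfilter : (Finset.univ.filter fun k : TorusSite 2 L => k ∈ l) = l.toFinset := by
    ext k; simp
  rw [hfilter, Finset.mul_sum]
  refine Finset.sum_congr rfl fun k _ => ?_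
  rw [show ((torusBand L k : ℝ) : ℂ) * 2 = ((2 * torusBand L k : ℝ) : ℂ) by push_cast; ring,
    Complex.ofReal_re]

/-- **Variational bound on the free sector ground energy**: for every finite set `F` of momenta
and `L ≥ 3`, `minEnergyOn H₀ (szSector (2|F|) 0) ≤ 2 Σ_{k ∈ F} ε_L(k)` (trial state `Φ_F`).
Bardeen–Cooper–Schrieffer (1957) §II; Tasaki (2020) §2.2. [folklore] -/
theorem minEnergyOn_szSector_hubbardTorus_zero_le (hL : 3 ≤ L) (F : Finset (TorusSite 2 L)) :
    (hubbardTorus 2 L 1 0).minEnergyOn (szSector (Λ := FermionTorus 2 L) (2 * F.card) 0) ≤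
      2 * ∑ k ∈ F, torusBand L k := by
  classical
  have hnd : F.toList.Nodup := F.nodup_toList
  have hlen : F.toList.length = F.card := F.length_toList
  have hset : F.toList.toFinset = F := F.toList_toFinset
  have hH : (hubbardTorus 2 L 1 0).IsHermitian := LiebThm1.hamiltonian_isHermitian _ 1 0
  have hmem : ((List.prod (List.map (fun k : TorusSite 2 L => (pairMode k)ᴴ) F.toList)) *ᵥ (vacuum : Fock (Orb (FermionTorus 2 L)))) ∈ szSector (Λ := FermionTorus 2 L) (2 * F.card) 0 := by
    rw [← hlen]; exact pairedState_mem_szSector F.toList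
  have h := minEnergyOn_le_rayleigh_of_mem hH _ hmem (star_pairedState_dotProduct_self hnd)
  rwa [re_expect_hubbardTorus_zero_pairedState hL hnd, hset] at h

end Trial

/-! ### The energy excess controls the occupation deviations -/

section Deviation

variable {L : ℕ} [NeZero L]

/-- **Energy above the free sector ground energy controls the smearing of the Fermi surface.**
For `L ≥ 3` and a unit vector `ψ ∈ szSector (2n) 0` of the fermionic torus there is a Fermi level
`ε_F` (of the `n` lowest band energies) with
`Σ_k |ε_L(k) - ε_F| · x_k (1 - x_k) ≤ Re ⟨ψ, H₀ ψ⟩ - minEnergyOn H₀ (szSector (2n) 0)`,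
`x_k = Re ⟨ψ, n_{k↑} ψ⟩`, `H₀ = hubbardTorus 2 L 1 0` (bathtub bound with deviations for the `↑`
occupations, plain bathtub bound for the `↓` ones, and the paired trial state for the ground
energy). Bardeen–Cooper–Schrieffer (1957) §II; Lieb–Loss (2001) Thm 1.14. [folklore] -/
theorem sum_abs_sub_fermiLevel_mul_le_energy_excess (hL : 3 ≤ L) {n : ℕ}
    {ψ : Fock (Orb (FermionTorus 2 L))} (hψ : ψ ∈ szSector (Λ := FermionTorus 2 L) (2 * n) 0)
    (h1 : star ψ ⬝ᵥ ψ = 1) :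
    ∃ eF : ℝ, ∑ k : TorusSite 2 L, |torusBand L k - eF| *
        ((star ψ ⬝ᵥ (momentumNumber k 0 *ᵥ ψ)).re * (1 - (star ψ ⬝ᵥ (momentumNumber k 0 *ᵥ ψ)).re)) ≤
      (star ψ ⬝ᵥ (hubbardTorus 2 L 1 0 *ᵥ ψ)).re -
        (hubbardTorus 2 L 1 0).minEnergyOn (szSector (Λ := FermionTorus 2 L) (2 * n) 0) := by
  have hsec : IsInSector n n ψ := (mem_szSector_two_mul_zero_iff n ψ).1 hψ
  have h0 : ψ ≠ 0 := by rintro rfl; simp at h1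
  obtain ⟨s, hs⟩ := Function.ne_iff.1 h0
  have hns : (upPart s).card = n := (not_imp_comm.1 (hsec s) hs).1
  have hn : n ≤ Fintype.card (TorusSite 2 L) := by
    rw [card_torusSite, ← hns]
    calc (upPart s).card ≤ (Finset.univ : Finset (FermionTorus 2 L)).card := Finset.card_le_univ _
      _ = L ^ 2 := by simp
  obtain ⟨F, eF, hFc, hF, hF'⟩ := exists_fermiSet (torusBand L) hn
  refine ⟨eF, ?_⟩
  set x : TorusSite 2 L → ℝ := fun k => (star ψ ⬝ᵥ (momentumNumber k 0 *ᵥ ψ)).re with hx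
  have hx0 : ∀ k, 0 ≤ x k := fun k => (re_expect_momentumNumber_mem_Icc k 0 ψ).1
  have hx1 : ∀ k, x k ≤ 1 := fun k => by
    have := (re_expect_momentumNumber_mem_Icc k 0 ψ).2
    rwa [h1, Complex.one_re] at this
  have hz0 : ∀ k : TorusSite 2 L, 0 ≤ (star ψ ⬝ᵥ (momentumNumber (-k) 1 *ᵥ ψ)).re := fun k =>
    (re_expect_momentumNumber_mem_Icc (-k) 1 ψ).1
  have hz1 : ∀ k : TorusSite 2 L, (star ψ ⬝ᵥ (momentumNumber (-k) 1 *ᵥ ψ)).re ≤ 1 := fun k => by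
    have := (re_expect_momentumNumber_mem_Icc (-k) 1 ψ).2
    rwa [h1, Complex.one_re] at this
  have hxs : ∑ k, x k = F.card := by
    rw [hFc]
    have := sum_re_expect_momentumNumber_up (L := L) hsec
    rwa [h1, Complex.one_re, mul_one] at this
  have hzs : ∑ k : TorusSite 2 L, (star ψ ⬝ᵥ (momentumNumber (-k) 1 *ᵥ ψ)).re = F.card := by
    rw [hFc]
    have := sum_re_expect_momentumNumber_down (L := L) hsec
    rw [h1, Complex.one_re, mul_one] at this
    rw [← this]
    exact Equiv.sum_comp (Equiv.neg (TorusSite 2 L))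
      (fun k => (star ψ ⬝ᵥ (momentumNumber k 1 *ᵥ ψ)).re)
  -- the energy expectation over time-reversed pairs
  have hE : (star ψ ⬝ᵥ (hubbardTorus 2 L 1 0 *ᵥ ψ)).re =
      ∑ k, torusBand L k * x k + ∑ k : TorusSite 2 L, torusBand L k *
        (star ψ ⬝ᵥ (momentumNumber (-k) 1 *ᵥ ψ)).re := by
    rw [← hubbardTorusWith_zero, hubbardTorusWith_zero_eq_sum_pairBlock_kinetic hL 0, Matrix.sum_mulVec,
      dotProduct_sum, Complex.re_sum, ← Finset.sum_add_distrib]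
    refine Finset.sum_congr rfl fun k _ => ?_
    rw [Matrix.smul_mulVec, dotProduct_smul, smul_eq_mul, Complex.re_ofReal_mul, add_mulVec,
      dotProduct_add, Complex.add_re, sub_zero]
    ring
  have hbx := sum_fermiSet_add_deviation_le (torusBand L) x F eF hF hF' hx0 hx1 hxs
  have hbz := sum_fermiSet_le (torusBand L) (fun k => (star ψ ⬝ᵥ (momentumNumber (-k) 1 *ᵥ ψ)).re)
    F eF hF hF' hz0 hz1 hzs
  have hmin := minEnergyOn_szSector_hubbardTorus_zero_le hL F
  rw [hFc] at hmin
  rw [hE]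
  linarith

end Deviation

end Literature.MathematicalPhysics.QuantumLattice
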